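import Summits.KontsevichZagierPeriods.KontsevichZagierPeriods.Theses.IsogenyCertificates
import Literature.NumberTheory.EllipticCurves.XMapCertificate
import Literature.NumberTheory.Transcendental.SemialgebraicMapsProofs
import Literature.NumberTheory.Transcendental.KZCalculusProofs

/-!
# Disproof of `XMapPeriodTransfer` (crux stmt-KontsevichZagierPeriods-10665) — findings

Standing-adversary work file of the crux disprover (route IsogenyCertificates, rank-3 crux, "L").
Everything below is `sorry`-free unless marked; prose only in docstrings.

**VERDICT SO FAR: NO KILL — and no kill is possible short of refuting Conjecture 1 itself on an
equal-valued pair (`counterexample_shape`).** The values of `r`, `r′` are EQUAL BY HYPOTHESIS, and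
the only invariant of `KZ.Equivalent` available in the tree (or in print) is the value
(`KZ.Equivalent.value_eq_holds`); every degenerate datum admitted by the typed shape (common factors
of `f, g`, `[−1]`, scalings, 2-torsion translates, non-surjective real images) induces a genuine real
covering `{P>0} ∖ Z(gW) → {P′>0}` with constant fibre multiplicity per component (paper analysis in NOTES; numerics: 163/163 ℚ-isogeny data pass, see NUMERICS below).

## Index
* §0 `IsDatum`, `Transfer`, `xMapPeriodTransfer_iff` (the datum is only used EXISTENTIALLY),
  `xMapPeriodTransfer_iff_certificate` (= tree predicate `HasXMapCertificate`, Washington §2.9),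
  `xMapPeriodTransfer_of_realPeriodSectorComplete` (crux #4 ⇒ crux #3).
* §1 LOAD-BEARING, datum side: `withoutWronskian_iff_sectorComplete`,
  `withoutIdentity_iff_sectorComplete` — dropping either datum conjunct collapses the crux onto
  crux #4 (transcendence-strength, no `¬`-theorem possible); `IsDatum.g_ne_zero/f_ne_zero/c_ne_zero`
  (forced non-degeneracy: no junk datum); `xMapPeriodTransfer_iff_coprime` (the planner's fallback
  "require gcd(f,g)=1" is EQUIVALENT, not a repair); `isDatum_id/neg/scale/lemniscate/lemniscate_dual`
  (data in scope with `c<0`, `|c|≠1`, real kernel, and `m₁ = 0` — the egg′↔unbounded′ step is exercised).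
* §2 KZ helpers: `equivalent_of_eqOn`, `of_mem_relations_of_eqOn_zero`, `equivalent_of_equivalent_neg`.
* §3 VALUE SIDE: `value_eq` (`r.value = a·∫_{P>0}dx/√P`), `integrableOn_of_rep` (integrability is
  inherited from `r`), `period_pos` (`∫_{P>0}dx/√P > 0`), `value_pos`.
* §4 NON-VACUITY: `fermatRep a = [{x³+1>0}, a/√(x³+1)]` is a genuine `KZ.IntegralRep 1`
  (`isSemialgebraicFunOn_integrand` for all `A B a`; integrability proved for `y² = x³+1`).
* §5 LOAD-BEARING, value side: `xMapPeriodTransfer_false_without_valueEq` (**any proof must use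
  `r.value = r′.value`**; witness `(A,B)=(A′,B′)=(0,1)`, identity datum, `(a,b)=(2,1)`),
  `false_with_commensurable_values` (ℚ-proportional values do not suffice either).
* §6 COSMETIC hypotheses: `xMapPeriodTransfer_iff_anySign` — `0 < a`, `0 < b` can be dropped
  (mixed signs are vacuous by `value_pos`, `a = b = 0` is a relation, both negative by negation).
* §7 The DIAGONAL case is a theorem: `transfer_self` (`Transfer A B A B`; the last step of the
  planner's chain — value equality + `Ω > 0` pins the scalar, one integrand-additivity move).
* §8 WHY IT RESISTS / targets: `counterexample_shape`; no stuck stubs yet (payload.targets = ∅).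

LANDED as importable theorems (namespaces `Summit.KontsevichZagierPeriods.IsogenyCertificates.XMapPeriodTransferDatum`
/ `…XMapPeriodTransferValue`; all under `Theorems/XMapPeriodTransfer/Negative/`):
`LoadBearingDatum.lean` (p72773: `iff_exists_datum`, `exists_datum_iff_hasXMapCertificate`, `iff_certificate`,
`iff_coprime`, `withoutWronskian_iff_sectorComplete`, `withoutIdentity_iff_sectorComplete`, `datum_neg/scale/
lemniscate/lemniscate_dual`); `ValueSide.lean` (p74312: `value_eq`, `integrableOn_of_rep`, `period_pos`,
`value_pos`, `transfer_diagonal`, `iff_anySign`, `equivalent_of_eqOn`, `equivalent_of_equivalent_neg`);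
`ValueEqLoadBearing.lean` (p74632: `isSemialgebraic_setOf_cubic_pos`, `isSemialgebraicFunOn_integrand`,
`exists_rep_fermat`, `false_without_valueEq`, `false_with_commensurable_values`); `LemniscateReps.lean`
(p74833: `integrableOn_inv_sqrt_cube_sub_self`, `integrableOn_inv_sqrt_cube_add_four_mul`,
`exists_rep_lemniscate`, `exists_rep_four`); `NaiveConstants.lean` (p74961: `not_naiveMultiplier`,
`not_naiveDegree`). NUMERICS (PARI/GP 2.15.4, script `num/xmapcheck.gp` v8 in the seat folder; kit jobs j014123 'xmapcheck8s' and
j014124 'xmapcheck8' — compute evidence auto-attached to the item): for the first curve E of each of the 19 Cremona classes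
11a 14a 15a 17a 19a 20a 21a 24a 26b 27a 30a 32a 36a 37b 49a 50a 54a 121b 162b (short integral models) and EVERY curve E′
Q-isogenous to it (`ellisomat`, Vélu x-maps R = F/H², degrees 2,3,4,5,6,7,9,11,12,14,15,21), plus the degree-37 isogeny of
class 1225.b (j = −9317; the route's "cheapest falsifier") and the CM 67-isogeny (j = −5280³), and for each such datum ALSO
its composites with every rational 2-torsion translation of E′ (76 extra data): **163/163 data pass** — (1) c² = P·R′²/P′(R)
is a constant (= 1, Vélu normalisation); (2) the fibre count N(X) = #{x ∈ ℝ : R(x) = X} is CONSTANT on each component of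
{P′>0} (5 rational samples per component) and every real preimage lies in {P>0}; (3) |c|·Ω(E) = m_egg·Ω_egg(E′) +
m_unb·Ω_unb(E′) holds to ≤ 1.6e−58 (periods by AGM, `ellinit([a4,a6]).omega[1]` = ∫_{unbounded}dx/√P); (4) on two-component
targets Ω_egg = Ω_unb (quadrature of the factored cubic vs AGM, to 1e−20). Observed multiplicity vectors (m_egg, m_unb):
(1), (5), (3), (7), (11), (21), (1,1), (2,2), (3,3), (4,4), (0,2), (2,0), (0,4), (4,0), (0,6), (6,0), (0,12), (12,0), (2), (4) —
in particular images missing the egg entirely AND (after a 2-torsion translate) images inside the egg only both occur, so the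
egg′↔unbounded′ Möbius step of the proof plan is exercised in both directions; 37- and 67-isogenies: m = 1 (non-real kernel).
Caveat recorded for provers doing certified numerics: plain quadrature of 1/√P in EXPANDED form fails near the roots for
Vélu models with large coefficients (v6/v7 of the script produced spurious residuals up to 66%); use root-offset factored
forms or AGM.
* §9 TIGHTNESS: `exists_rep_lemniscate`, `exists_rep_four` (the calibration pair `x³−x`, `x³+4x` as
  genuine reps: non-vacuity of LemniscateTwoIsogeny 5382); `not_naiveMultiplier` (constant `1/|c|` is
  WRONG), `not_naiveDegree` (constant `deg R/|c|` is WRONG): the real-fibre multiplicities `m₀, m₁`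
  (possibly `0`) are essential — refuted by soundness + `Ω > 0` alone, no period computed.
-/

noncomputable section

namespace Summit.KontsevichZagierPeriods.Cruxes.XMapPeriodTransfer.Disproof

open Polynomial Set MeasureTheory
open Literature.NumberTheory.Transcendental
open Literature.NumberTheory.EllipticCurves (HasXMapCertificate xMapWronskian)
open Summit.KontsevichZagierPeriods.KontsevichZagierPeriods.Theses.IsogenyCertificates

/-- The cubic `P(x) = x³ + Ax + B` as a real function of the single coordinate of `ℝ¹`
(reducible: unfolds to the crux's literal `x 0 ^ 3 + (A : ℝ) * x 0 + (B : ℝ)`). -/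
abbrev cubic (A B : ℤ) (x : Fin 1 → ℝ) : ℝ := x 0 ^ 3 + (A : ℝ) * x 0 + (B : ℝ)

/-! ## §0–§1 The datum side -/

/-- The x-rational isogeny datum, exactly as inlined (twice) in the crux: Wronskian
`W = f′g − fg′ ≠ 0` and `c²·g·(f³ + A′fg² + B′g³) = (X³+AX+B)·W²`. -/
def IsDatum (A B A' B' : ℤ) (f g : ℚ[X]) (c : ℚ) : Prop :=
  derivative f * g - f * derivative g ≠ 0 ∧
  C (c ^ 2) * g * (f ^ 3 + C (A' : ℚ) * f * g ^ 2 + C (B' : ℚ) * g ^ 3) =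
    (X ^ 3 + C (A : ℚ) * X + C (B : ℚ)) * (derivative f * g - f * derivative g) ^ 2

/-- The value-side block of the crux for one pair of curves: equal-valued
`[{P>0}, a/√P]`, `[{P′>0}, b/√P′]` (`a, b ∈ ℚ_{>0}`) are KZ-equivalent. -/
def Transfer (A B A' B' : ℤ) : Prop :=
  ∀ (a b : ℚ), 0 < a → 0 < b → ∀ (r r' : KZ.IntegralRep 1),
    r.domain = {x | 0 < x 0 ^ 3 + (A : ℝ) * x 0 + (B : ℝ)} →
    EqOn r.integrand (fun x => (a : ℝ) / Real.sqrt (x 0 ^ 3 + (A : ℝ) * x 0 + (B : ℝ))) r.domain →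
    r'.domain = {x | 0 < x 0 ^ 3 + (A' : ℝ) * x 0 + (B' : ℝ)} →
    EqOn r'.integrand (fun x => (b : ℝ) / Real.sqrt (x 0 ^ 3 + (A' : ℝ) * x 0 + (B' : ℝ))) r'.domain →
    r.value = r'.value → KZ.Equivalent r r'

/-- **Reformulation.** The datum `(f, g, c)` enters the crux only through its EXISTENCE: the
conclusion does not mention it. -/
theorem xMapPeriodTransfer_iff :
    XMapPeriodTransfer ↔ ∀ A B A' B' : ℤ, 4 * A ^ 3 + 27 * B ^ 2 ≠ 0 → 4 * A' ^ 3 + 27 * B' ^ 2 ≠ 0 →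
      (∃ (f g : ℚ[X]) (c : ℚ), IsDatum A B A' B' f g c) → Transfer A B A' B' := by
  constructor
  · rintro h A B A' B' hΔ hΔ' ⟨f, g, c, hW, hI⟩ a b ha hb r r' h1 h2 h3 h4 h5
    exact h A B A' B' hΔ hΔ' f g c hW hI a b ha hb r r' h1 h2 h3 h4 h5
  · intro h A B A' B' hΔ hΔ' f g c hW hI a b ha hb r r' h1 h2 h3 h4 h5
    exact h A B A' B' hΔ hΔ' ⟨f, g, c, hW, hI⟩ a b ha hb r r' h1 h2 h3 h4 h5

/-- Crux #4 of the route in the same vocabulary: `Transfer` for ALL nonsingular pairs. -/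
theorem realPeriodSectorComplete_iff :
    RealPeriodSectorComplete ↔ ∀ A B A' B' : ℤ, 4 * A ^ 3 + 27 * B ^ 2 ≠ 0 →
      4 * A' ^ 3 + 27 * B' ^ 2 ≠ 0 → Transfer A B A' B' :=
  Iff.rfl

/-- The crux is formally WEAKER than crux #4 (`RealPeriodSectorComplete`). -/
theorem xMapPeriodTransfer_of_realPeriodSectorComplete (h : RealPeriodSectorComplete) :
    XMapPeriodTransfer :=
  xMapPeriodTransfer_iff.2 fun A B A' B' hΔ hΔ' _ => h A B A' B' hΔ hΔ'

/-! ## Load-bearing analysis, I: the two datum conjuncts -/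

/-- The crux with the Wronskian conjunct `W ≠ 0` dropped. -/
def XMapPeriodTransferWithoutWronskian : Prop :=
  ∀ A B A' B' : ℤ, 4 * A ^ 3 + 27 * B ^ 2 ≠ 0 → 4 * A' ^ 3 + 27 * B' ^ 2 ≠ 0 →
    (∃ (f g : ℚ[X]) (c : ℚ), C (c ^ 2) * g * (f ^ 3 + C (A' : ℚ) * f * g ^ 2 + C (B' : ℚ) * g ^ 3) =
      (X ^ 3 + C (A : ℚ) * X + C (B : ℚ)) * (derivative f * g - f * derivative g) ^ 2) →
    Transfer A B A' B'

/-- The crux with the identity conjunct dropped. -/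
def XMapPeriodTransferWithoutIdentity : Prop :=
  ∀ A B A' B' : ℤ, 4 * A ^ 3 + 27 * B ^ 2 ≠ 0 → 4 * A' ^ 3 + 27 * B' ^ 2 ≠ 0 →
    (∃ (f g : ℚ[X]), derivative f * g - f * derivative g ≠ 0) → Transfer A B A' B'

/-- Without `W ≠ 0` the identity is solved by `g = 0` for EVERY pair: the crux becomes crux #4. -/
theorem withoutWronskian_iff_sectorComplete :
    XMapPeriodTransferWithoutWronskian ↔ RealPeriodSectorComplete := by
  constructor
  · intro h A B A' B' hΔ hΔ'
    exact h A B A' B' hΔ hΔ' ⟨0, 0, 0, by simp⟩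
  · intro h A B A' B' hΔ hΔ' _
    exact h A B A' B' hΔ hΔ'

/-- Without the identity, `W ≠ 0` is solved by `(f, g) = (X, 1)` for EVERY pair: crux #4 again. -/
theorem withoutIdentity_iff_sectorComplete :
    XMapPeriodTransferWithoutIdentity ↔ RealPeriodSectorComplete := by
  constructor
  · intro h A B A' B' hΔ hΔ'
    exact h A B A' B' hΔ hΔ' ⟨X, 1, by simp⟩
  · intro h A B A' B' hΔ hΔ' _
    exact h A B A' B' hΔ hΔ'

/-! ## The datum class: forced non-degeneracy, bridge to the tree predicate, WLOG coprime -/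

namespace IsDatum

variable {A B A' B' : ℤ} {f g : ℚ[X]} {c : ℚ}

/-- `g ≠ 0` is forced by `W ≠ 0`. -/
theorem g_ne_zero (h : IsDatum A B A' B' f g c) : g ≠ 0 := by
  rintro rfl; exact h.1 (by simp)

/-- `f ≠ 0` is forced by `W ≠ 0`. -/
theorem f_ne_zero (h : IsDatum A B A' B' f g c) : f ≠ 0 := by
  rintro rfl; exact h.1 (by simp)

/-- The Weierstrass cubic `X³ + AX + B` is never the zero polynomial (it is monic). -/
theorem cubic_ne_zero (A B : ℤ) : (X ^ 3 + C (A : ℚ) * X + C (B : ℚ) : ℚ[X]) ≠ 0 := by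
  have hm : (X ^ 3 + (C (A : ℚ) * X + C (B : ℚ)) : ℚ[X]).Monic :=
    monic_X_pow_add (degree_linear_le.trans_lt (by norm_num))
  rw [← add_assoc] at hm
  exact hm.ne_zero

/-- `c ≠ 0` is forced (else `P·W² = 0` with `P ≠ 0`, `W ≠ 0` in the domain `ℚ[X]`). -/
theorem c_ne_zero (h : IsDatum A B A' B' f g c) : c ≠ 0 := by
  rintro rfl
  have h2 := h.2
  simp only [ne_eq, OfNat.ofNat_ne_zero, not_false_eq_true, zero_pow, map_zero, zero_mul] at h2
  exact (mul_ne_zero (cubic_ne_zero A B) (pow_ne_zero 2 h.1)) h2.symm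

/-- Closure under a common factor: `(f, g, c) ↦ (h f, h g, c)`, `h ≠ 0` (non-reduced `f/g` ARE in
scope; they induce the same real covering off the zeros of `h`). -/
theorem mul_left (hd : IsDatum A B A' B' f g c) {h : ℚ[X]} (hh : h ≠ 0) :
    IsDatum A B A' B' (h * f) (h * g) c := by
  have hW : derivative (h * f) * (h * g) - h * f * derivative (h * g) =
      h ^ 2 * (derivative f * g - f * derivative g) := by
    simp only [derivative_mul]; ring
  refine ⟨?_, ?_⟩
  · rw [hW]; exact mul_ne_zero (pow_ne_zero 2 hh) hd.1
  · rw [hW]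
    have := hd.2
    calc C (c ^ 2) * (h * g) * ((h * f) ^ 3 + C (A' : ℚ) * (h * f) * (h * g) ^ 2 + C (B' : ℚ) * (h * g) ^ 3)
        = h ^ 4 * (C (c ^ 2) * g * (f ^ 3 + C (A' : ℚ) * f * g ^ 2 + C (B' : ℚ) * g ^ 3)) := by ring
      _ = h ^ 4 * ((X ^ 3 + C (A : ℚ) * X + C (B : ℚ)) * (derivative f * g - f * derivative g) ^ 2) := by rw [this]
      _ = _ := by ring

end IsDatum

/-- **Bridge.** The crux's inlined datum is, up to `eq_comm` and the two forced conjuncts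
`g ≠ 0`, `c ≠ 0`, the landed Literature predicate
`Literature.NumberTheory.EllipticCurves.HasXMapCertificate` (XMapCertificate.lean, Washington 2008
§2.9). -/
theorem exists_isDatum_iff_hasXMapCertificate (A B A' B' : ℤ) :
    (∃ (f g : ℚ[X]) (c : ℚ), IsDatum A B A' B' f g c) ↔
      HasXMapCertificate (A : ℚ) (B : ℚ) (A' : ℚ) (B' : ℚ) := by
  constructor
  · rintro ⟨f, g, c, hd⟩
    exact ⟨f, g, c, hd.g_ne_zero, hd.c_ne_zero, hd.1, hd.2.symm⟩
  · rintro ⟨f, g, u, -, -, hW, hI⟩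
    exact ⟨f, g, u, hW, hI.symm⟩

/-- The crux over the tree predicate (5-line restatement for provers). -/
theorem xMapPeriodTransfer_iff_certificate :
    XMapPeriodTransfer ↔ ∀ A B A' B' : ℤ, 4 * A ^ 3 + 27 * B ^ 2 ≠ 0 → 4 * A' ^ 3 + 27 * B' ^ 2 ≠ 0 →
      HasXMapCertificate (A : ℚ) (B : ℚ) (A' : ℚ) (B' : ℚ) → Transfer A B A' B' := by
  rw [xMapPeriodTransfer_iff]
  refine forall₄_congr fun A B A' B' => ?_
  rw [exists_isDatum_iff_hasXMapCertificate]

/-- **WLOG `f, g` coprime** (`HasXMapCertificate.exists_isCoprime`: divide by the gcd): the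
planner's fallback restatement "require gcd(f,g) = 1" (KILL CRITERIA) is EQUIVALENT to the crux
as typed, not weaker — no refutation can come from non-reduced data. -/
theorem xMapPeriodTransfer_iff_coprime :
    XMapPeriodTransfer ↔ ∀ A B A' B' : ℤ, 4 * A ^ 3 + 27 * B ^ 2 ≠ 0 → 4 * A' ^ 3 + 27 * B' ^ 2 ≠ 0 →
      (∃ (f g : ℚ[X]) (c : ℚ), IsCoprime f g ∧ IsDatum A B A' B' f g c) → Transfer A B A' B' := by
  rw [xMapPeriodTransfer_iff_certificate]
  refine forall₄_congr fun A B A' B' => ?_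
  refine forall₂_congr fun _ _ => ?_
  refine Iff.intro (fun h ⟨f, g, c, _, hd⟩ => h ⟨f, g, c, hd.g_ne_zero, hd.c_ne_zero, hd.1, hd.2.symm⟩)
    (fun h hc => ?_)
  obtain ⟨f, g, u, hcop, -, -, hW, hI⟩ := hc.exists_isCoprime
  exact h ⟨f, g, u, hcop, hW, hI.symm⟩

/-! ## Degenerate data that ARE in scope (all induce genuine real coverings) -/

/-- The identity datum `(X, 1, 1)` joins every curve to itself. -/
theorem isDatum_id (A B : ℤ) : IsDatum A B A B X 1 1 := by
  refine ⟨by simp, Polynomial.funext fun x => ?_⟩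
  simp

/-- The inversion datum `(X, 1, −1)` (the automorphism `[−1]`, same x-map): `c < 0` occurs. -/
theorem isDatum_neg (A B : ℤ) : IsDatum A B A B X 1 (-1) := by
  refine ⟨by simp, Polynomial.funext fun x => ?_⟩
  simp

/-- The scaling datum `(u²X, 1, u⁻¹)`, `u ∈ ℤ ∖ {0}`: the isomorphism `(x,y) ↦ (u²x, u³y)` onto
`(A′, B′) = (u⁴A, u⁶B)`; `|c| ≠ 1` occurs without any kernel. -/
theorem isDatum_scale (A B : ℤ) (u : ℤ) (hu : u ≠ 0) :
    IsDatum A B (u ^ 4 * A) (u ^ 6 * B) (C ((u : ℚ) ^ 2) * X) 1 ((u : ℚ)⁻¹) := by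
  have hu' : (u : ℚ) ≠ 0 := by exact_mod_cast hu
  have hW : derivative (C ((u : ℚ) ^ 2) * X) * (1 : ℚ[X]) - C ((u : ℚ) ^ 2) * X * derivative (1 : ℚ[X]) =
      C ((u : ℚ) ^ 2) := by
    simp only [derivative_mul, derivative_C, zero_mul, derivative_X, mul_one, zero_add,
      derivative_one, mul_zero, sub_zero]
  refine ⟨?_, ?_⟩
  · rw [hW]; exact C_ne_zero.mpr (pow_ne_zero 2 hu')
  · rw [hW]
    refine Polynomial.funext fun x => ?_
    simp only [eval_mul, eval_C, eval_add, eval_pow, eval_X, Int.cast_mul, Int.cast_pow,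
      one_pow, mul_one]
    field_simp

/-- The lemniscate 2-isogeny datum `(X² − 1, X, 1)` from `y² = x³ − x` to `y² = x³ + 4x`
(route support item LemniscateTwoIsogeny; tree: `hasXMapCertificate_lemniscate`; the kernel point
`(0,0)` is REAL: two sheets `(−1,0)`, `(1,∞)`, each onto `(0,∞)`, so `m₀ = 2`, `|c| = 1`). -/
theorem isDatum_lemniscate : IsDatum (-1) 0 4 0 (X ^ 2 - 1) X 1 := by
  have hW : derivative (X ^ 2 - 1 : ℚ[X]) * X - (X ^ 2 - 1) * derivative X = X ^ 2 + 1 := by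
    simp only [derivative_sub, derivative_X_pow, derivative_one, derivative_X, Nat.cast_ofNat,
      map_ofNat, Nat.add_one_sub_one, pow_one]
    ring
  refine ⟨?_, Polynomial.funext fun x => ?_⟩
  · rw [hW]; intro h0
    have := congrArg (fun p : ℚ[X] => p.eval 0) h0
    norm_num at this
  · rw [hW]; simp; ring

/-- The dual direction `y² = x³ + 4x → y² = x³ − x` (`φ̂`, with `φ̂ ∘ φ = [2]`, so `c = 2`):
datum `(X² + 4, 4X, 2)`;
`R = (x² + 4)/(4x)` maps `{x³+4x>0} = (0,∞)` 2 : 1 onto `(1,∞)` — the UNBOUNDED component of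
`{x³ − x > 0}` only: the egg `(−1,0)` is not hit (`m₁ = 0`, `m₀ = 2`), so the egg′ ↔ unbounded′
Möbius step of the proof plan is genuinely exercised by data in scope. -/
theorem isDatum_lemniscate_dual : IsDatum 4 0 (-1) 0 (X ^ 2 + 4) (4 * X) 2 := by
  have hW : derivative (X ^ 2 + 4 : ℚ[X]) * (4 * X) - (X ^ 2 + 4) * derivative (4 * X) =
      4 * X ^ 2 - 16 := by
    simp only [derivative_add, derivative_X_pow, derivative_mul, derivative_X, Nat.cast_ofNat,
      map_ofNat, derivative_ofNat, Nat.add_one_sub_one, pow_one, zero_mul, zero_add, add_zero,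
      mul_one]
    ring
  refine ⟨?_, Polynomial.funext fun x => ?_⟩
  · rw [hW]; intro h0
    have := congrArg (fun p : ℚ[X] => p.eval 0) h0
    norm_num at this
  · rw [hW]; simp; ring


/-! ## KZ helpers (re-proved locally; cf. ModularSymbolRep `equivalent_of_eqOn`) -/

/-- The zero representation on a `ℚ`-semialgebraic domain. -/
def zeroRep {n : ℕ} (s : Set (Fin n → ℝ))
    (hs : Literature.ModelTheory.ExponentialFields.IsSemialgebraic ℚ s) : KZ.IntegralRep n where
  domain := s
  integrand := 0
  isSemialgebraic_domain := hs
  isSemialgebraicFunOn_integrand :=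
    (isSemialgebraicFunOn_aeval hs (0 : MvPolynomial (Fin n) ℚ)).congr fun x _ => by simp
  integrableOn := integrableOn_zero

/-- `[zero representation] ∈ relations` (integrand additivity `0 = 0 + 0`). -/
theorem of_zeroRep_mem_relations {n : ℕ} (s : Set (Fin n → ℝ))
    (hs : Literature.ModelTheory.ExponentialFields.IsSemialgebraic ℚ s) :
    KZ.of (zeroRep s hs) ∈ KZ.relations := by
  have h : KZ.of (zeroRep s hs) - KZ.of (zeroRep s hs) - KZ.of (zeroRep s hs) ∈ KZ.relations :=
    KZ.integrandAddRel_subset_relations ⟨n, _, _, _, rfl, rfl, fun x _ => by simp [zeroRep], rfl⟩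
  rw [sub_self, zero_sub] at h
  simpa using KZ.relations.neg_mem h

/-- Same domain, integrands agreeing on it ⇒ KZ-equivalent (one integrand-additivity move). -/
theorem equivalent_of_eqOn {n : ℕ} (r r' : KZ.IntegralRep n) (hd : r'.domain = r.domain)
    (he : EqOn r.integrand r'.integrand r.domain) : KZ.Equivalent r r' := by
  have h1 : KZ.of r - KZ.of r' - KZ.of (zeroRep r.domain r.isSemialgebraic_domain) ∈ KZ.relations :=
    KZ.integrandAddRel_subset_relations ⟨n, r, r', zeroRep r.domain r.isSemialgebraic_domain, hd,
      rfl, fun x hx => by simp [zeroRep, he hx], rfl⟩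
  have h2 := of_zeroRep_mem_relations r.domain r.isSemialgebraic_domain
  have := KZ.relations.add_mem h1 h2
  rwa [sub_add_cancel] at this

/-- A representation whose integrand vanishes on its domain is a relation. -/
theorem of_mem_relations_of_eqOn_zero {n : ℕ} (r : KZ.IntegralRep n) (he : EqOn r.integrand 0 r.domain) :
    KZ.of r ∈ KZ.relations := by
  have h1 : KZ.Equivalent r (zeroRep r.domain r.isSemialgebraic_domain) :=
    equivalent_of_eqOn r _ rfl (fun x hx => by simp [zeroRep, he hx])
  have h2 := of_zeroRep_mem_relations r.domain r.isSemialgebraic_domain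
  have := KZ.relations.add_mem h1 h2
  simpa using this

/-- `[r] + [r.neg] ∈ relations`. -/
theorem of_add_of_neg_mem_relations {n : ℕ} (r : KZ.IntegralRep n) :
    KZ.of r + KZ.of r.neg ∈ KZ.relations := by
  have h1 : KZ.of (zeroRep r.domain r.isSemialgebraic_domain) - KZ.of r - KZ.of r.neg ∈ KZ.relations :=
    KZ.integrandAddRel_subset_relations ⟨n, zeroRep r.domain r.isSemialgebraic_domain, r, r.neg, rfl,
      rfl, fun x _ => by simp [zeroRep], rfl⟩
  have h2 := of_zeroRep_mem_relations r.domain r.isSemialgebraic_domain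
  have := KZ.relations.sub_mem h2 h1
  rwa [show KZ.of (zeroRep r.domain r.isSemialgebraic_domain) -
      (KZ.of (zeroRep r.domain r.isSemialgebraic_domain) - KZ.of r - KZ.of r.neg) =
      KZ.of r + KZ.of r.neg by abel] at this

/-- Equivalence of the negatives ⇒ equivalence. -/
theorem equivalent_of_equivalent_neg {n m : ℕ} (r : KZ.IntegralRep n) (r' : KZ.IntegralRep m)
    (h : KZ.Equivalent r.neg r'.neg) : KZ.Equivalent r r' := by
  have h1 := of_add_of_neg_mem_relations r
  have h2 := of_add_of_neg_mem_relations r'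
  have := KZ.relations.sub_mem (KZ.relations.sub_mem h1 h2) h
  unfold KZ.Equivalent at h ⊢
  rwa [show KZ.of r + KZ.of r.neg - (KZ.of r' + KZ.of r'.neg) - (KZ.of r.neg - KZ.of r'.neg) =
    KZ.of r - KZ.of r' by abel] at this

/-! ## The value of a real-period representation: `r.value = a · ∫_{P>0} dx/√P`, and its sign -/

section Value

variable {A B : ℤ} {a : ℚ}

theorem measurable_inv_sqrt_cubic (A B : ℤ) :
    Measurable fun x : Fin 1 → ℝ => 1 / Real.sqrt (cubic A B x) := by
  unfold cubic; fun_prop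

/-- `{P > 0}` is non-empty: `P(1 + |A| + |B|) > 0`. -/
theorem cubic_pos_large (A B : ℤ) : 0 < cubic A B (fun _ => 1 + |(A : ℝ)| + |(B : ℝ)|) := by
  simp only [cubic]
  set t : ℝ := 1 + |(A : ℝ)| + |(B : ℝ)| with ht
  have hA : -|(A : ℝ)| ≤ (A : ℝ) := neg_abs_le _
  have hB : -|(B : ℝ)| ≤ (B : ℝ) := neg_abs_le _
  have h0A : 0 ≤ |(A : ℝ)| := abs_nonneg _
  have h0B : 0 ≤ |(B : ℝ)| := abs_nonneg _
  have ht1 : 1 ≤ t := by rw [ht]; linarith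
  nlinarith [mul_le_mul_of_nonneg_left hA (by linarith : (0:ℝ) ≤ t), sq_nonneg t,
    mul_le_mul_of_nonneg_left ht1 (by linarith : (0:ℝ) ≤ t)]

/-- `{P > 0} ⊆ ℝ¹` has positive (indeed infinite) volume: it is open and non-empty. -/
theorem volume_setOf_cubic_pos_pos (A B : ℤ) : 0 < volume {x : Fin 1 → ℝ | 0 < cubic A B x} := by
  have hopen : IsOpen {x : Fin 1 → ℝ | 0 < cubic A B x} := by
    unfold cubic; exact isOpen_lt continuous_const (by fun_prop)
  exact hopen.measure_pos volume ⟨_, cubic_pos_large A B⟩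

/-- **Value formula.** For any representation with the crux's domain/integrand data,
`r.value = a · ∫_{P>0} dx/√P`, the latter integrand being integrable. -/
theorem value_eq (r : KZ.IntegralRep 1) (hd : r.domain = {x | 0 < cubic A B x})
    (he : EqOn r.integrand (fun x => (a : ℝ) / Real.sqrt (cubic A B x)) r.domain) :
    r.value = (a : ℝ) * ∫ x in {x | 0 < cubic A B x}, 1 / Real.sqrt (cubic A B x) := by
  rw [KZ.IntegralRep.value, setIntegral_congr_fun (KZ.IntegralRep.measurableSet_domain_holds r) he, hd,
    ← integral_const_mul]
  congr 1; ext x; ring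

/-- Integrability of `dx/√P` on `{P>0}` is INHERITED from any representation with `a ≠ 0`. -/
theorem integrableOn_of_rep (r : KZ.IntegralRep 1) (hd : r.domain = {x | 0 < cubic A B x})
    (he : EqOn r.integrand (fun x => (a : ℝ) / Real.sqrt (cubic A B x)) r.domain) (ha : a ≠ 0) :
    IntegrableOn (fun x => 1 / Real.sqrt (cubic A B x)) {x | 0 < cubic A B x} := by
  have h1 : IntegrableOn (fun x => (a : ℝ) / Real.sqrt (cubic A B x)) {x | 0 < cubic A B x} := by
    rw [← hd]; exact r.integrableOn.congr_fun he (KZ.IntegralRep.measurableSet_domain_holds r)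
  have h2 : IntegrableOn (fun x => (a : ℝ)⁻¹ * ((a : ℝ) / Real.sqrt (cubic A B x))) {x | 0 < cubic A B x} :=
    h1.const_mul ((a : ℝ)⁻¹)
  refine IntegrableOn.congr_fun h2 (fun x _ => ?_) (hd ▸ KZ.IntegralRep.measurableSet_domain_holds r)
  have : (a : ℝ) ≠ 0 := by exact_mod_cast ha
  field_simp

/-- **Positivity of the real period**: if `dx/√P` is integrable on `{P>0}` then its integral is
`> 0` (positive integrand on an open non-empty set). -/
theorem period_pos (hint : IntegrableOn (fun x => 1 / Real.sqrt (cubic A B x)) {x | 0 < cubic A B x}) :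
    0 < ∫ x in {x | 0 < cubic A B x}, 1 / Real.sqrt (cubic A B x) := by
  have hmeas : MeasurableSet {x : Fin 1 → ℝ | 0 < cubic A B x} :=
    measurableSet_lt measurable_const (by unfold cubic; fun_prop)
  rw [setIntegral_pos_iff_support_of_nonneg_ae ?_ hint]
  · have hsub : {x : Fin 1 → ℝ | 0 < cubic A B x} ⊆
        Function.support (fun x => 1 / Real.sqrt (cubic A B x)) ∩ {x | 0 < cubic A B x} := by
      intro x hx
      refine ⟨?_, hx⟩
      simp only [Function.mem_support, ne_eq, one_div, inv_eq_zero]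
      exact (Real.sqrt_pos.mpr hx).ne'
    exact (volume_setOf_cubic_pos_pos A B).trans_le (measure_mono hsub)
  · filter_upwards [ae_restrict_mem hmeas] with x hx
    exact div_nonneg zero_le_one (Real.sqrt_nonneg _)

/-- Hence `r.value` has the sign of `a`. -/
theorem value_pos (r : KZ.IntegralRep 1) (hd : r.domain = {x | 0 < cubic A B x})
    (he : EqOn r.integrand (fun x => (a : ℝ) / Real.sqrt (cubic A B x)) r.domain) (ha : 0 < a) :
    0 < r.value := by
  rw [value_eq r hd he]
  exact mul_pos (by exact_mod_cast ha) (period_pos (integrableOn_of_rep r hd he ha.ne'))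

end Value

/-! ## The diagonal case of the crux is TRUE (last step of the proof plan, certified) -/

/-- **`Transfer A B A B` holds**: two representations of `a·Ω`, `b·Ω` on the same `{P>0}` with
equal values have `a = b` (`Ω > 0`), hence agree on the domain: one integrand-additivity move. -/
theorem transfer_self (A B : ℤ) (a b : ℚ) (ha : 0 < a) (_hb : 0 < b) (r r' : KZ.IntegralRep 1)
    (h1 : r.domain = {x | 0 < cubic A B x})
    (h2 : EqOn r.integrand (fun x => (a : ℝ) / Real.sqrt (cubic A B x)) r.domain)
    (h3 : r'.domain = {x | 0 < cubic A B x})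
    (h4 : EqOn r'.integrand (fun x => (b : ℝ) / Real.sqrt (cubic A B x)) r'.domain)
    (h5 : r.value = r'.value) : KZ.Equivalent r r' := by
  have hI := period_pos (integrableOn_of_rep r h1 h2 ha.ne')
  rw [value_eq r h1 h2, value_eq r' h3 h4] at h5
  have hab : (a : ℝ) = b := by
    have := mul_right_cancel₀ hI.ne' h5
    exact this
  refine equivalent_of_eqOn r r' (h3.trans h1.symm) fun x hx => ?_
  rw [h2 hx, h4 (h3.symm ▸ h1 ▸ hx : x ∈ r'.domain), hab]


/-! ## Semialgebraicity of the crux's domain and integrand (general `A, B, a`) -/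

/-- `{P > 0} ⊆ ℝ¹` is `ℚ`-semialgebraic. -/
theorem isSemialgebraic_setOf_cubic_pos (A B : ℤ) :
    Literature.ModelTheory.ExponentialFields.IsSemialgebraic ℚ {x : Fin 1 → ℝ | 0 < cubic A B x} := by
  have h := Literature.ModelTheory.ExponentialFields.isSemialgebraic_setOf_eval_pos (k := ℚ) (R := ℝ)
    (MvPolynomial.X 0 ^ 3 + MvPolynomial.C (A : ℚ) * MvPolynomial.X 0 + MvPolynomial.C (B : ℚ) :
      MvPolynomial (Fin 1) ℚ)
  convert h using 2 with x
  simp [cubic]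

/-- `x ↦ a/√P(x)` is a `ℚ`-semialgebraic function on `{P > 0}`: it agrees there with
`√P · (a/P)` (product of the square root of a polynomial and a quotient of polynomials;
Tarski–Seidenberg via the tree's `IsSemialgebraicFunOn.mul_holds` / `sqrt_holds`). -/
theorem isSemialgebraicFunOn_integrand (A B : ℤ) (a : ℚ) :
    IsSemialgebraicFunOn ℚ {x : Fin 1 → ℝ | 0 < cubic A B x}
      (fun x => (a : ℝ) / Real.sqrt (cubic A B x)) := by
  set P : MvPolynomial (Fin 1) ℚ :=
    MvPolynomial.X 0 ^ 3 + MvPolynomial.C (A : ℚ) * MvPolynomial.X 0 + MvPolynomial.C (B : ℚ) with hPdef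
  have hP : ∀ x : Fin 1 → ℝ, MvPolynomial.aeval x P = cubic A B x := fun x => by simp [hPdef, cubic]
  have hs := isSemialgebraic_setOf_cubic_pos A B
  have h1 : IsSemialgebraicFunOn ℚ {x : Fin 1 → ℝ | 0 < cubic A B x} (fun x => MvPolynomial.aeval x P) :=
    isSemialgebraicFunOn_aeval hs P
  have h2 := IsSemialgebraicFunOn.sqrt_holds h1
  have h3 : IsSemialgebraicFunOn ℚ {x : Fin 1 → ℝ | 0 < cubic A B x}
      (fun x => MvPolynomial.aeval x (MvPolynomial.C a) / MvPolynomial.aeval x P) :=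
    isSemialgebraicFunOn_aeval_div_aeval hs _ _ fun x hx => by rw [hP]; exact (ne_of_gt hx)
  have h4 := IsSemialgebraicFunOn.mul_holds h2 h3
  refine h4.congr fun x hx => ?_
  have hx' : 0 < cubic A B x := hx
  simp only [Pi.mul_apply, hP, MvPolynomial.algHom_C, eq_ratCast]
  have hs0 : Real.sqrt (cubic A B x) ≠ 0 := (Real.sqrt_pos.2 hx').ne'
  rw [eq_div_iff hs0]
  have hcc : Real.sqrt (cubic A B x) * Real.sqrt (cubic A B x) = cubic A B x :=
    Real.mul_self_sqrt hx'.le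
  calc Real.sqrt (cubic A B x) * ((a : ℝ) / cubic A B x) * Real.sqrt (cubic A B x)
      = (Real.sqrt (cubic A B x) * Real.sqrt (cubic A B x)) * ((a : ℝ) / cubic A B x) := by ring
    _ = cubic A B x * ((a : ℝ) / cubic A B x) := by rw [hcc]
    _ = (a : ℝ) := mul_div_cancel₀ _ hx'.ne'

/-! ## An explicit representation: `y² = x³ + 1` (non-vacuity of the crux's hypotheses) -/

/-- `t³ + 1 > 0 ↔ t > −1`. -/
theorem cube_add_one_pos_iff (t : ℝ) : 0 < t ^ 3 + 1 ↔ -1 < t := by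
  have h : t ^ 3 + 1 = (t + 1) * (t ^ 2 - t + 1) := by ring
  have hq : 0 < t ^ 2 - t + 1 := by nlinarith [sq_nonneg (t - 1/2)]
  rw [h]
  constructor
  · intro hp
    by_contra hle
    nlinarith [mul_le_mul_of_nonneg_right (not_lt.mp hle) hq.le]
  · intro ht; exact mul_pos (by linarith) hq

/-- `dt/√(t³ + 1)` is integrable on `(−1, ∞)`: `≤ 2(t+1)^{−1/2}` on `(−1, 1]`, `≤ t^{−3/2}` on
`(1, ∞)`. -/
theorem integrableOn_inv_sqrt_cube_add_one :
    IntegrableOn (fun t : ℝ => 1 / Real.sqrt (t ^ 3 + 1)) (Ioi (-1)) := by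
  have hmeas : Measurable fun t : ℝ => 1 / Real.sqrt (t ^ 3 + 1) := by fun_prop
  rw [← Ioc_union_Ioi_eq_Ioi (show (-1 : ℝ) ≤ 1 by norm_num)]
  refine IntegrableOn.union ?_ ?_
  · have hg : IntegrableOn (fun t : ℝ => 2 * (t + 1) ^ (-(1 / 2 : ℝ))) (Ioc (-1) 1) := by
      have h1 : IntervalIntegrable (fun x : ℝ => x ^ (-(1 / 2 : ℝ))) volume 0 2 :=
        intervalIntegral.intervalIntegrable_rpow' (by norm_num)
      have h2 := h1.comp_add_right 1
      have h3 : IntervalIntegrable (fun x : ℝ => (x + 1) ^ (-(1 / 2 : ℝ))) volume (-1) 1 := by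
        convert h2 using 2 <;> norm_num
      have h4 := (intervalIntegrable_iff_integrableOn_Ioc_of_le (by norm_num : (-1 : ℝ) ≤ 1)).mp h3
      exact h4.const_mul 2
    refine Integrable.mono' hg hmeas.aestronglyMeasurable ?_
    filter_upwards [ae_restrict_mem measurableSet_Ioc] with t ht
    rw [Real.norm_eq_abs, abs_of_nonneg (div_nonneg zero_le_one (Real.sqrt_nonneg _))]
    have ht1 : 0 < t + 1 := by linarith [ht.1]
    have hP : 0 < t ^ 3 + 1 := (cube_add_one_pos_iff t).2 ht.1
    rw [Real.rpow_neg ht1.le, ← Real.sqrt_eq_rpow, ← div_eq_mul_inv,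
      div_le_div_iff₀ (Real.sqrt_pos.2 hP) (Real.sqrt_pos.2 ht1), one_mul]
    have h4 : Real.sqrt 4 = 2 := by
      rw [show (4 : ℝ) = 2 ^ 2 by norm_num, Real.sqrt_sq (by norm_num)]
    calc Real.sqrt (t + 1) ≤ Real.sqrt (4 * (t ^ 3 + 1)) :=
          Real.sqrt_le_sqrt (by nlinarith [sq_nonneg (2 * t - 1)])
      _ = 2 * Real.sqrt (t ^ 3 + 1) := by rw [Real.sqrt_mul (by norm_num), h4]
  · have hg : IntegrableOn (fun t : ℝ => t ^ (-(3 / 2) : ℝ)) (Ioi 1) :=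
      integrableOn_Ioi_rpow_of_lt (by norm_num) one_pos
    refine Integrable.mono' hg hmeas.aestronglyMeasurable ?_
    filter_upwards [ae_restrict_mem measurableSet_Ioi] with t ht
    rw [Real.norm_eq_abs, abs_of_nonneg (div_nonneg zero_le_one (Real.sqrt_nonneg _))]
    have ht0 : 0 < t := by linarith [ht.out]
    rw [Real.rpow_neg ht0.le, ← one_div]
    apply one_div_le_one_div_of_le (Real.rpow_pos_of_pos ht0 _)
    have h32 : t ^ ((3 / 2 : ℝ)) = Real.sqrt (t ^ 3) := by
      rw [Real.sqrt_eq_rpow, ← Real.rpow_natCast t 3, ← Real.rpow_mul ht0.le]; norm_num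
    rw [h32]
    exact Real.sqrt_le_sqrt (by linarith)

/-- `{x | 0 < x₀³ + 0·x₀ + 1} = {x | −1 < x₀}` as a preimage under `ℝ¹ ≃ ℝ`. -/
theorem setOf_fermat_eq :
    {x : Fin 1 → ℝ | 0 < cubic 0 1 x} = (MeasurableEquiv.funUnique (Fin 1) ℝ) ⁻¹' Ioi (-1) := by
  ext x
  simp [cubic, MeasurableEquiv.funUnique, Fin.default_eq_zero, cube_add_one_pos_iff]

/-- Integrability of `a/√(x³+1)` on `{x³ + 1 > 0} ⊆ ℝ¹`. -/
theorem integrableOn_fermat (a : ℚ) :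
    IntegrableOn (fun x : Fin 1 → ℝ => (a : ℝ) / Real.sqrt (cubic 0 1 x)) {x | 0 < cubic 0 1 x} := by
  have hmp := MeasureTheory.volume_preserving_funUnique (Fin 1) ℝ
  rw [setOf_fermat_eq]
  have h := (hmp.integrableOn_comp_preimage (MeasurableEquiv.measurableEmbedding _)).mpr
    (integrableOn_inv_sqrt_cube_add_one.const_mul (a : ℝ))
  refine IntegrableOn.congr_fun h (fun x _ => ?_) (measurableSet_Ioi.preimage (MeasurableEquiv.measurable _))
  simp [cubic, MeasurableEquiv.funUnique, Fin.default_eq_zero, div_eq_mul_inv]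

/-- **The representation `[{x³ + 1 > 0}, a/√(x³+1)]`** (`y² = x³ + 1`, `(A, B) = (0, 1)`,
nonsingular: `4·0 + 27 = 27 ≠ 0`). Its value is `a · ∫_{−1}^{∞} dx/√(x³+1) = a · Γ(1/3)³/(2^{4/3}·√3·π)·…`
— the number is irrelevant here, only `> 0` is used. -/
def fermatRep (a : ℚ) : KZ.IntegralRep 1 where
  domain := {x | 0 < cubic 0 1 x}
  integrand x := (a : ℝ) / Real.sqrt (cubic 0 1 x)
  isSemialgebraic_domain := isSemialgebraic_setOf_cubic_pos 0 1
  isSemialgebraicFunOn_integrand := isSemialgebraicFunOn_integrand 0 1 a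
  integrableOn := integrableOn_fermat a

/-- NON-VACUITY: the `r`-hypotheses of the crux are inhabited (literal shape, `(A,B) = (0,1)`). -/
theorem exists_rep_fermat (a : ℚ) : ∃ r : KZ.IntegralRep 1,
    r.domain = {x | 0 < x 0 ^ 3 + ((0 : ℤ) : ℝ) * x 0 + ((1 : ℤ) : ℝ)} ∧
    EqOn r.integrand (fun x => (a : ℝ) / Real.sqrt (x 0 ^ 3 + ((0 : ℤ) : ℝ) * x 0 + ((1 : ℤ) : ℝ))) r.domain :=
  ⟨fermatRep a, rfl, fun _ _ => rfl⟩


/-! ## §5 LOAD-BEARING, value side: `r.value = r'.value` cannot be dropped or weakened -/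

/-- The crux with the hypothesis `r.value = r'.value` DELETED (everything else verbatim). -/
def XMapPeriodTransferWithoutValueEq : Prop :=
  ∀ (A B A' B' : ℤ), 4 * A ^ 3 + 27 * B ^ 2 ≠ 0 → 4 * A' ^ 3 + 27 * B' ^ 2 ≠ 0 →
    ∀ (f g : ℚ[X]) (c : ℚ), derivative f * g - f * derivative g ≠ 0 →
    C (c ^ 2) * g * (f ^ 3 + C (A' : ℚ) * f * g ^ 2 + C (B' : ℚ) * g ^ 3) =
      (X ^ 3 + C (A : ℚ) * X + C (B : ℚ)) * (derivative f * g - f * derivative g) ^ 2 →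
    ∀ (a b : ℚ), 0 < a → 0 < b → ∀ (r r' : KZ.IntegralRep 1),
      r.domain = {x | 0 < x 0 ^ 3 + (A : ℝ) * x 0 + (B : ℝ)} →
      EqOn r.integrand (fun x => (a : ℝ) / Real.sqrt (x 0 ^ 3 + (A : ℝ) * x 0 + (B : ℝ))) r.domain →
      r'.domain = {x | 0 < x 0 ^ 3 + (A' : ℝ) * x 0 + (B' : ℝ)} →
      EqOn r'.integrand (fun x => (b : ℝ) / Real.sqrt (x 0 ^ 3 + (A' : ℝ) * x 0 + (B' : ℝ))) r'.domain →
      KZ.Equivalent r r'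

/-- **Any proof must use `r.value = r'.value`.** Witness: `(A,B) = (A′,B′) = (0,1)` (`y² = x³+1`),
the identity datum `(X, 1, 1)`, `(a, b) = (2, 1)`, `r = fermatRep 2`, `r′ = fermatRep 1`: the
weakened statement makes them equivalent, soundness gives `2Ω = Ω`, but `Ω = ∫_{−1}^∞ dx/√(x³+1) > 0`. -/
theorem xMapPeriodTransfer_false_without_valueEq : ¬ XMapPeriodTransferWithoutValueEq := by
  intro h
  have hd := isDatum_id 0 1
  have h2 : KZ.Equivalent (fermatRep 2) (fermatRep 1) :=
    h 0 1 0 1 (by norm_num) (by norm_num) X 1 1 hd.1 hd.2 2 1 (by norm_num) (by norm_num)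
      (fermatRep 2) (fermatRep 1) rfl (fun _ _ => rfl) rfl (fun _ _ => rfl)
  have hv : (fermatRep 2).value = (fermatRep 1).value := KZ.Equivalent.value_eq_holds h2
  rw [value_eq (A := 0) (B := 1) (a := 2) (fermatRep 2) rfl (fun _ _ => rfl),
    value_eq (A := 0) (B := 1) (a := 1) (fermatRep 1) rfl (fun _ _ => rfl)] at hv
  have hI := period_pos (A := 0) (B := 1)
    (integrableOn_of_rep (a := 1) (fermatRep 1) rfl (fun _ _ => rfl) one_ne_zero)
  push_cast at hv
  linarith

/-- The crux with `r.value = r'.value` WEAKENED to ℚ-proportionality `∃ q, r.value = q · r'.value`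
(the natural "commensurable periods" reading). -/
def XMapPeriodTransferCommensurable : Prop :=
  ∀ (A B A' B' : ℤ), 4 * A ^ 3 + 27 * B ^ 2 ≠ 0 → 4 * A' ^ 3 + 27 * B' ^ 2 ≠ 0 →
    ∀ (f g : ℚ[X]) (c : ℚ), derivative f * g - f * derivative g ≠ 0 →
    C (c ^ 2) * g * (f ^ 3 + C (A' : ℚ) * f * g ^ 2 + C (B' : ℚ) * g ^ 3) =
      (X ^ 3 + C (A : ℚ) * X + C (B : ℚ)) * (derivative f * g - f * derivative g) ^ 2 →
    ∀ (a b : ℚ), 0 < a → 0 < b → ∀ (r r' : KZ.IntegralRep 1),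
      r.domain = {x | 0 < x 0 ^ 3 + (A : ℝ) * x 0 + (B : ℝ)} →
      EqOn r.integrand (fun x => (a : ℝ) / Real.sqrt (x 0 ^ 3 + (A : ℝ) * x 0 + (B : ℝ))) r.domain →
      r'.domain = {x | 0 < x 0 ^ 3 + (A' : ℝ) * x 0 + (B' : ℝ)} →
      EqOn r'.integrand (fun x => (b : ℝ) / Real.sqrt (x 0 ^ 3 + (A' : ℝ) * x 0 + (B' : ℝ))) r'.domain →
      (∃ q : ℚ, r.value = (q : ℝ) * r'.value) → KZ.Equivalent r r'

/-- **Commensurability of the values does not suffice** (same witness, `q = 2`): the relation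
`[r] − [r′]` needs EXACT value equality; `aΩ = q·bΩ′` is the relation `[r] ~ [q·r′]`, a different
element of the formal group. -/
theorem false_with_commensurable_values : ¬ XMapPeriodTransferCommensurable := by
  intro h
  have hd := isDatum_id 0 1
  have hval : ∀ a : ℚ, (fermatRep a).value =
      (a : ℝ) * ∫ x in {x | 0 < cubic 0 1 x}, 1 / Real.sqrt (cubic 0 1 x) :=
    fun a => value_eq (A := 0) (B := 1) (a := a) (fermatRep a) rfl (fun _ _ => rfl)
  have h2 : KZ.Equivalent (fermatRep 2) (fermatRep 1) :=
    h 0 1 0 1 (by norm_num) (by norm_num) X 1 1 hd.1 hd.2 2 1 (by norm_num) (by norm_num)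
      (fermatRep 2) (fermatRep 1) rfl (fun _ _ => rfl) rfl (fun _ _ => rfl)
      ⟨2, by rw [hval 2, hval 1]; push_cast; ring⟩
  have hv : (fermatRep 2).value = (fermatRep 1).value := KZ.Equivalent.value_eq_holds h2
  rw [hval 2, hval 1] at hv
  have hI := period_pos (A := 0) (B := 1)
    (integrableOn_of_rep (a := 1) (fermatRep 1) rfl (fun _ _ => rfl) one_ne_zero)
  push_cast at hv
  linarith

/-! ## §6 COSMETIC hypotheses: the signs of `a`, `b` -/

/-- `Transfer` with the hypotheses `0 < a`, `0 < b` deleted. -/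
def TransferAnySign (A B A' B' : ℤ) : Prop :=
  ∀ (a b : ℚ) (r r' : KZ.IntegralRep 1),
    r.domain = {x | 0 < x 0 ^ 3 + (A : ℝ) * x 0 + (B : ℝ)} →
    EqOn r.integrand (fun x => (a : ℝ) / Real.sqrt (x 0 ^ 3 + (A : ℝ) * x 0 + (B : ℝ))) r.domain →
    r'.domain = {x | 0 < x 0 ^ 3 + (A' : ℝ) * x 0 + (B' : ℝ)} →
    EqOn r'.integrand (fun x => (b : ℝ) / Real.sqrt (x 0 ^ 3 + (A' : ℝ) * x 0 + (B' : ℝ))) r'.domain →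
    r.value = r'.value → KZ.Equivalent r r'

/-- Negating the scalar negates the representation's data. -/
theorem eqOn_neg_integrand {A B : ℤ} {a : ℚ} (r : KZ.IntegralRep 1)
    (he : EqOn r.integrand (fun x => (a : ℝ) / Real.sqrt (cubic A B x)) r.domain) :
    EqOn r.neg.integrand (fun x => ((-a : ℚ) : ℝ) / Real.sqrt (cubic A B x)) r.neg.domain := by
  intro x hx
  simp only [KZ.IntegralRep.integrand_neg, Pi.neg_apply, Rat.cast_neg, neg_div]
  rw [he hx]

/-- **The sign hypotheses are removable**: `Transfer → TransferAnySign`. Mixed signs and exactly one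
zero are VACUOUS (`value_pos`: the value has the sign of the scalar), `a = b = 0` gives two
relations, and `a, b < 0` follows from the positive case by negating both representations. -/
theorem transferAnySign_of_transfer {A B A' B' : ℤ} (h : Transfer A B A' B') :
    TransferAnySign A B A' B' := by
  intro a b r r' h1 h2 h3 h4 h5
  have pos_r : 0 < a → 0 < r.value := fun ha => value_pos r h1 h2 ha
  have pos_r' : 0 < b → 0 < r'.value := fun hb => value_pos r' h3 h4 hb
  have neg_r : a < 0 → r.value < 0 := fun ha => by
    have := value_pos (a := -a) r.neg h1 (eqOn_neg_integrand r h2) (by linarith)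
    rw [KZ.IntegralRep.value_neg] at this; linarith
  have neg_r' : b < 0 → r'.value < 0 := fun hb => by
    have := value_pos (a := -b) r'.neg h3 (eqOn_neg_integrand r' h4) (by linarith)
    rw [KZ.IntegralRep.value_neg] at this; linarith
  have zero_r : a = 0 → r.value = 0 := fun ha => by
    rw [value_eq r h1 h2, ha]; simp
  have zero_r' : b = 0 → r'.value = 0 := fun hb => by
    rw [value_eq r' h3 h4, hb]; simp
  rcases lt_trichotomy 0 a with ha | rfl | ha <;> rcases lt_trichotomy 0 b with hb | rfl | hb
  · exact h a b ha hb r r' h1 h2 h3 h4 h5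
  · exfalso; linarith [pos_r ha, zero_r' rfl]
  · exfalso; linarith [pos_r ha, neg_r' hb]
  · exfalso; linarith [pos_r' hb, zero_r rfl]
  · -- both scalars vanish: both representations are relations
    have hr : KZ.of r ∈ KZ.relations :=
      of_mem_relations_of_eqOn_zero r fun x hx => by simp [h2 hx]
    have hr' : KZ.of r' ∈ KZ.relations :=
      of_mem_relations_of_eqOn_zero r' fun x hx => by simp [h4 hx]
    exact KZ.relations.sub_mem hr hr'
  · exfalso; linarith [neg_r' hb, zero_r rfl]
  · exfalso; linarith [neg_r ha, pos_r' hb]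
  · exfalso; linarith [neg_r ha, zero_r' rfl]
  · apply equivalent_of_equivalent_neg
    exact h (-a) (-b) (by linarith) (by linarith) r.neg r'.neg h1 (eqOn_neg_integrand r h2) h3
      (eqOn_neg_integrand r' h4) (by simp [h5])

/-- Hence the crux is EQUIVALENT to its sign-free form. -/
theorem xMapPeriodTransfer_iff_anySign :
    XMapPeriodTransfer ↔ ∀ A B A' B' : ℤ, 4 * A ^ 3 + 27 * B ^ 2 ≠ 0 → 4 * A' ^ 3 + 27 * B' ^ 2 ≠ 0 →
      (∃ (f g : ℚ[X]) (c : ℚ), IsDatum A B A' B' f g c) → TransferAnySign A B A' B' := by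
  rw [xMapPeriodTransfer_iff]
  refine forall₄_congr fun A B A' B' => forall₃_congr fun _ _ _ => ⟨transferAnySign_of_transfer, ?_⟩
  exact fun h a b _ _ r r' h1 h2 h3 h4 h5 => h a b r r' h1 h2 h3 h4 h5

/-! ## §8 WHY IT RESISTS -/

/-- **The summit implies the crux** (so a kill here kills Conjecture 1): an equal-valued pair
`r, r′` is equivalent to an equal-valued RATIONAL pair (`KZ.exists_isRational_equivalent_holds`,
KZ §1.1 "algebraic ⇒ rational by more variables"), to which the summit applies. -/
theorem of_summit (hK : KontsevichZagierPeriods) : XMapPeriodTransfer := by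
  intro A B A' B' _ _ f g c _ _ a b _ _ r r' _ _ _ _ h5
  obtain ⟨m, s, hs, hrs⟩ := KZ.exists_isRational_equivalent_holds r
  obtain ⟨m', s', hs', hrs'⟩ := KZ.exists_isRational_equivalent_holds r'
  have hv : s.value = s'.value := by
    rw [← KZ.Equivalent.value_eq_holds hrs, ← KZ.Equivalent.value_eq_holds hrs', h5]
  exact (hrs.trans (hK s s' hs hs' hv)).trans hrs'.symm

/-- Contrapositive: a refutation of the crux refutes the summit `KontsevichZagierPeriods`. -/
theorem not_summit_of_not (h : ¬ XMapPeriodTransfer) : ¬ KontsevichZagierPeriods :=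
  fun hK => h (of_summit hK)

/-- **Shape of any counterexample**: an x-map-joined pair of curves and an equal-valued pair of
real-period representations which is NOT KZ-equivalent — i.e. an element of `ker eval ∖ relations`
of Conjecture-1 type. No invariant separating `relations` inside `ker eval` is known. -/
theorem counterexample_shape :
    ¬ XMapPeriodTransfer ↔ ∃ A B A' B' : ℤ, 4 * A ^ 3 + 27 * B ^ 2 ≠ 0 ∧ 4 * A' ^ 3 + 27 * B' ^ 2 ≠ 0 ∧
      (∃ (f g : ℚ[X]) (c : ℚ), IsDatum A B A' B' f g c) ∧
      ∃ (a b : ℚ), 0 < a ∧ 0 < b ∧ ∃ (r r' : KZ.IntegralRep 1),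
        r.domain = {x | 0 < cubic A B x} ∧
        EqOn r.integrand (fun x => (a : ℝ) / Real.sqrt (cubic A B x)) r.domain ∧
        r'.domain = {x | 0 < cubic A' B' x} ∧
        EqOn r'.integrand (fun x => (b : ℝ) / Real.sqrt (cubic A' B' x)) r'.domain ∧
        r.value = r'.value ∧ ¬ KZ.Equivalent r r' := by
  rw [xMapPeriodTransfer_iff]
  simp only [Transfer, not_forall, exists_prop]

/-! ## §9 TIGHTNESS of the bookkeeping: the lemniscate pair; the constant is neither `1/|c|` nor `deg/|c|` -/

/-! #### Integrability for the lemniscate pair `x³ − x`, `x³ + 4x` -/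

/-- `t³ + 4t > 0 ↔ t > 0`. [folklore] -/
theorem cube_add_four_mul_pos_iff (t : ℝ) : 0 < t ^ 3 + 4 * t ↔ 0 < t := by
  have h : t ^ 3 + 4 * t = t * (t ^ 2 + 4) := by ring
  have hq : 0 < t ^ 2 + 4 := by positivity
  rw [h]
  constructor
  · intro hp; by_contra hle
    nlinarith [mul_le_mul_of_nonneg_right (not_lt.mp hle) hq.le]
  · intro ht; exact mul_pos ht hq

/-- `dt/√(t³ + 4t)` is integrable on `(0, ∞)`: `≤ t^{−1/2}` on `(0,1]`, `≤ t^{−3/2}` on `(1,∞)`. [folklore] -/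
theorem integrableOn_inv_sqrt_cube_add_four_mul :
    IntegrableOn (fun t : ℝ => 1 / Real.sqrt (t ^ 3 + 4 * t)) (Ioi 0) := by
  have hmeas : Measurable fun t : ℝ => 1 / Real.sqrt (t ^ 3 + 4 * t) := by fun_prop
  rw [← Ioc_union_Ioi_eq_Ioi (show (0 : ℝ) ≤ 1 by norm_num)]
  refine IntegrableOn.union ?_ ?_
  · have hg : IntegrableOn (fun t : ℝ => t ^ (-(1 / 2 : ℝ))) (Ioc 0 1) :=
      (intervalIntegrable_iff_integrableOn_Ioc_of_le zero_le_one).mp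
        (intervalIntegral.intervalIntegrable_rpow' (by norm_num))
    refine Integrable.mono' hg hmeas.aestronglyMeasurable ?_
    filter_upwards [ae_restrict_mem measurableSet_Ioc] with t ht
    rw [Real.norm_eq_abs, abs_of_nonneg (div_nonneg zero_le_one (Real.sqrt_nonneg _))]
    have ht0 : 0 < t := ht.1
    have hP : 0 < t ^ 3 + 4 * t := by positivity
    rw [Real.rpow_neg ht0.le, ← Real.sqrt_eq_rpow, ← one_div]
    apply one_div_le_one_div_of_le (Real.sqrt_pos.2 ht0)
    exact Real.sqrt_le_sqrt (by nlinarith [pow_pos ht0 3])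
  · have hg : IntegrableOn (fun t : ℝ => t ^ (-(3 / 2) : ℝ)) (Ioi 1) :=
      integrableOn_Ioi_rpow_of_lt (by norm_num) one_pos
    refine Integrable.mono' hg hmeas.aestronglyMeasurable ?_
    filter_upwards [ae_restrict_mem measurableSet_Ioi] with t ht
    rw [Real.norm_eq_abs, abs_of_nonneg (div_nonneg zero_le_one (Real.sqrt_nonneg _))]
    have ht0 : 0 < t := by linarith [ht.out]
    rw [Real.rpow_neg ht0.le, ← one_div]
    apply one_div_le_one_div_of_le (Real.rpow_pos_of_pos ht0 _)
    have h32 : t ^ ((3 / 2 : ℝ)) = Real.sqrt (t ^ 3) := by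
      rw [Real.sqrt_eq_rpow, ← Real.rpow_natCast t 3, ← Real.rpow_mul ht0.le]; norm_num
    rw [h32]
    exact Real.sqrt_le_sqrt (by nlinarith [pow_pos ht0 3])

/-- `t³ − t > 0 ↔ t ∈ (−1, 0) ∪ (1, ∞)`. [folklore] -/
theorem cube_sub_self_pos_iff (t : ℝ) : 0 < t ^ 3 - t ↔ t ∈ Ioo (-1 : ℝ) 0 ∪ Ioi 1 := by
  simp only [mem_union, mem_Ioo, mem_Ioi]
  have hfac : t ^ 3 - t = t * (t - 1) * (t + 1) := by ring
  constructor
  · intro h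
    rcases lt_or_ge 1 t with h2 | h2
    · exact Or.inr h2
    · left
      refine ⟨?_, ?_⟩
      · by_contra h3
        have h3' : t ≤ -1 := not_lt.mp h3
        nlinarith [mul_le_mul_of_nonpos_left (show (0:ℝ) ≤ t ^ 2 - 1 by nlinarith) (show t ≤ 0 by linarith)]
      · by_contra h3
        have h3' : 0 ≤ t := not_lt.mp h3
        nlinarith [mul_le_mul_of_nonneg_left (show t ^ 2 - 1 ≤ 0 by nlinarith) h3']
  · rintro (⟨h1, h2⟩ | h)
    · rw [hfac]; exact mul_pos (mul_pos_of_neg_of_neg h2 (by linarith)) (by linarith)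
    · rw [hfac]; exact mul_pos (mul_pos (by linarith) (by linarith)) (by linarith)

/-- `1/√(u(1−u)) ≤ 1/√u + 1/√(1 − u)` on `(0,1)` (since `√u + √(1−u) ≥ u + (1−u) = 1`). [folklore] -/
theorem inv_sqrt_mul_le {u : ℝ} (h0 : 0 < u) (h1 : u < 1) :
    1 / Real.sqrt (u * (1 - u)) ≤ 1 / Real.sqrt u + 1 / Real.sqrt (1 - u) := by
  have h1' : 0 < 1 - u := by linarith
  have hsu : 0 < Real.sqrt u := Real.sqrt_pos.2 h0
  have hs1 : 0 < Real.sqrt (1 - u) := Real.sqrt_pos.2 h1'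
  have hsum : 1 ≤ Real.sqrt u + Real.sqrt (1 - u) := by
    have a1 : u ≤ Real.sqrt u := by
      conv_lhs => rw [← Real.sqrt_sq h0.le]
      exact Real.sqrt_le_sqrt (by nlinarith)
    have a2 : 1 - u ≤ Real.sqrt (1 - u) := by
      conv_lhs => rw [← Real.sqrt_sq h1'.le]
      exact Real.sqrt_le_sqrt (by nlinarith)
    linarith
  rw [Real.sqrt_mul h0.le, div_add_div _ _ hsu.ne' hs1.ne', one_mul, mul_one,
    div_le_div_iff₀ (mul_pos hsu hs1) (mul_pos hsu hs1), one_mul]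
  calc Real.sqrt u * Real.sqrt (1 - u) = 1 * (Real.sqrt u * Real.sqrt (1 - u)) := by ring
    _ ≤ (Real.sqrt (1 - u) + Real.sqrt u) * (Real.sqrt u * Real.sqrt (1 - u)) :=
        mul_le_mul_of_nonneg_right (by linarith) (mul_pos hsu hs1).le

/-- `dt/√(t³ − t)` is integrable on `{t³ − t > 0} = (−1,0) ∪ (1,∞)`: on `(−1,0)` it is
`≤ (−t)^{−1/2} + (t+1)^{−1/2}`, on `(1,2]` `≤ (t−1)^{−1/2}`, on `(2,∞)` `≤ 2t^{−3/2}`. [folklore] -/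
theorem integrableOn_inv_sqrt_cube_sub_self :
    IntegrableOn (fun t : ℝ => 1 / Real.sqrt (t ^ 3 - t)) (Ioo (-1 : ℝ) 0 ∪ Ioi 1) := by
  have hmeas : Measurable fun t : ℝ => 1 / Real.sqrt (t ^ 3 - t) := by fun_prop
  have hr : IntervalIntegrable (fun x : ℝ => x ^ (-(1 / 2 : ℝ))) volume 0 1 :=
    intervalIntegral.intervalIntegrable_rpow' (by norm_num)
  refine IntegrableOn.union ?_ ?_
  · -- the bounded sheet `(−1, 0)`
    have hg1 : IntegrableOn (fun t : ℝ => (-t) ^ (-(1 / 2 : ℝ))) (Ioo (-1 : ℝ) 0) := by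
      have h2 := (hr.comp_mul_left (c := -1)).symm
      have h3 : IntervalIntegrable (fun x : ℝ => (-x) ^ (-(1 / 2 : ℝ))) volume (-1) 0 := by
        convert h2 using 2 <;> norm_num
      exact ((intervalIntegrable_iff_integrableOn_Ioo_of_le (by norm_num : (-1 : ℝ) ≤ 0)).mp h3)
    have hg2 : IntegrableOn (fun t : ℝ => (t + 1) ^ (-(1 / 2 : ℝ))) (Ioo (-1 : ℝ) 0) := by
      have h2 := hr.comp_add_right 1
      have h3 : IntervalIntegrable (fun x : ℝ => (x + 1) ^ (-(1 / 2 : ℝ))) volume (-1) 0 := by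
        convert h2 using 2 <;> norm_num
      exact ((intervalIntegrable_iff_integrableOn_Ioo_of_le (by norm_num : (-1 : ℝ) ≤ 0)).mp h3)
    refine Integrable.mono' (hg1.add hg2) hmeas.aestronglyMeasurable ?_
    filter_upwards [ae_restrict_mem measurableSet_Ioo] with t ht
    rw [Real.norm_eq_abs, abs_of_nonneg (div_nonneg zero_le_one (Real.sqrt_nonneg _)), Pi.add_apply]
    have hu0 : 0 < -t := by linarith [ht.2]
    have hu1 : -t < 1 := by linarith [ht.1]
    have ht1 : 0 < t + 1 := by linarith [ht.1]
    rw [Real.rpow_neg hu0.le, Real.rpow_neg ht1.le, ← Real.sqrt_eq_rpow, ← Real.sqrt_eq_rpow,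
      ← one_div, ← one_div]
    have hP : (-t) * (1 - (-t)) ≤ t ^ 3 - t := by nlinarith [mul_nonneg (sq_nonneg t) ht1.le]
    have hPpos : 0 < (-t) * (1 - (-t)) := mul_pos hu0 (by linarith)
    calc 1 / Real.sqrt (t ^ 3 - t) ≤ 1 / Real.sqrt ((-t) * (1 - (-t))) :=
          one_div_le_one_div_of_le (Real.sqrt_pos.2 hPpos) (Real.sqrt_le_sqrt hP)
      _ ≤ 1 / Real.sqrt (-t) + 1 / Real.sqrt (1 - (-t)) := inv_sqrt_mul_le hu0 hu1
      _ = 1 / Real.sqrt (-t) + 1 / Real.sqrt (t + 1) := by ring_nf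
  · -- the unbounded sheet `(1, ∞) = (1, 2] ∪ (2, ∞)`
    rw [← Ioc_union_Ioi_eq_Ioi (show (1 : ℝ) ≤ 2 by norm_num)]
    refine IntegrableOn.union ?_ ?_
    · have hg : IntegrableOn (fun t : ℝ => (t + (-1)) ^ (-(1 / 2 : ℝ))) (Ioc (1 : ℝ) 2) := by
        have h2 := hr.comp_add_right (-1)
        have h3 : IntervalIntegrable (fun x : ℝ => (x + (-1)) ^ (-(1 / 2 : ℝ))) volume 1 2 := by
          convert h2 using 2 <;> norm_num
        exact ((intervalIntegrable_iff_integrableOn_Ioc_of_le (by norm_num : (1 : ℝ) ≤ 2)).mp h3)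
      refine Integrable.mono' hg hmeas.aestronglyMeasurable ?_
      filter_upwards [ae_restrict_mem measurableSet_Ioc] with t ht
      rw [Real.norm_eq_abs, abs_of_nonneg (div_nonneg zero_le_one (Real.sqrt_nonneg _))]
      have ht1 : 0 < t + (-1) := by linarith [ht.1]
      rw [Real.rpow_neg ht1.le, ← Real.sqrt_eq_rpow, ← one_div]
      apply one_div_le_one_div_of_le (Real.sqrt_pos.2 ht1)
      have hkey : 0 ≤ (t + (-1)) * (t ^ 2 + t - 1) := mul_nonneg ht1.le (by nlinarith [ht.1])
      exact Real.sqrt_le_sqrt (by nlinarith [hkey])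
    · have hg : IntegrableOn (fun t : ℝ => 2 * t ^ (-(3 / 2) : ℝ)) (Ioi 2) :=
        (integrableOn_Ioi_rpow_of_lt (by norm_num) two_pos).const_mul 2
      refine Integrable.mono' hg hmeas.aestronglyMeasurable ?_
      filter_upwards [ae_restrict_mem measurableSet_Ioi] with t ht
      rw [Real.norm_eq_abs, abs_of_nonneg (div_nonneg zero_le_one (Real.sqrt_nonneg _))]
      have ht2 : 2 < t := ht.out
      have ht0 : 0 < t := by linarith
      have h32 : t ^ ((3 / 2 : ℝ)) = Real.sqrt (t ^ 3) := by
        rw [Real.sqrt_eq_rpow, ← Real.rpow_natCast t 3, ← Real.rpow_mul ht0.le]; norm_num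
      have hprod : 0 < t * (t ^ 2 - 4) := mul_pos ht0 (by nlinarith)
      rw [Real.rpow_neg ht0.le, h32, ← div_eq_mul_inv,
        div_le_div_iff₀ (Real.sqrt_pos.2 (by nlinarith)) (Real.sqrt_pos.2 (by positivity)), one_mul]
      have h4 : Real.sqrt 4 = 2 := by
        rw [show (4 : ℝ) = 2 ^ 2 by norm_num, Real.sqrt_sq (by norm_num)]
      calc Real.sqrt (t ^ 3) ≤ Real.sqrt (4 * (t ^ 3 - t)) := Real.sqrt_le_sqrt (by nlinarith)
        _ = 2 * Real.sqrt (t ^ 3 - t) := by rw [Real.sqrt_mul (by norm_num), h4]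

/-! #### The two lemniscate representations (non-vacuity of LemniscateTwoIsogeny, stmt-5382) -/

/-- `[{x³ − x > 0}, a/√(x³ − x)]` is a genuine `KZ.IntegralRep 1` (literal shape of the crux at
`(A, B) = (−1, 0)`). [cite: KontsevichZagier2001, §1.1] -/
theorem exists_rep_lemniscate (a : ℚ) : ∃ r : KZ.IntegralRep 1,
    r.domain = {x : Fin 1 → ℝ | 0 < x 0 ^ 3 + ((-1 : ℤ) : ℝ) * x 0 + ((0 : ℤ) : ℝ)} ∧
    r.integrand = fun x => (a : ℝ) / Real.sqrt (x 0 ^ 3 + ((-1 : ℤ) : ℝ) * x 0 + ((0 : ℤ) : ℝ)) := by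
  have hmp := MeasureTheory.volume_preserving_funUnique (Fin 1) ℝ
  have hset : {x : Fin 1 → ℝ | 0 < x 0 ^ 3 + ((-1 : ℤ) : ℝ) * x 0 + ((0 : ℤ) : ℝ)} =
      (MeasurableEquiv.funUnique (Fin 1) ℝ) ⁻¹' (Ioo (-1 : ℝ) 0 ∪ Ioi 1) := by
    ext x
    simp only [Int.reduceNeg, Int.cast_neg, Int.cast_one, neg_mul, one_mul, Int.cast_zero, add_zero,
      mem_setOf_eq, mem_preimage]
    rw [← sub_eq_add_neg, cube_sub_self_pos_iff]
    simp [MeasurableEquiv.funUnique, Fin.default_eq_zero]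
  have hint : IntegrableOn (fun x : Fin 1 → ℝ => (a : ℝ) / Real.sqrt (x 0 ^ 3 + ((-1 : ℤ) : ℝ) * x 0 + ((0 : ℤ) : ℝ)))
      {x : Fin 1 → ℝ | 0 < x 0 ^ 3 + ((-1 : ℤ) : ℝ) * x 0 + ((0 : ℤ) : ℝ)} := by
    rw [hset]
    have h := (hmp.integrableOn_comp_preimage (MeasurableEquiv.measurableEmbedding _)).mpr
      (integrableOn_inv_sqrt_cube_sub_self.const_mul (a : ℝ))
    refine IntegrableOn.congr_fun h (fun x _ => ?_)
      ((measurableSet_Ioo.union measurableSet_Ioi).preimage (MeasurableEquiv.measurable _))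
    simp [MeasurableEquiv.funUnique, Fin.default_eq_zero, div_eq_mul_inv, sub_eq_add_neg]
  exact ⟨{ domain := _, integrand := _,
           isSemialgebraic_domain := isSemialgebraic_setOf_cubic_pos (-1) 0,
           isSemialgebraicFunOn_integrand := isSemialgebraicFunOn_integrand (-1) 0 a,
           integrableOn := hint }, rfl, rfl⟩

/-- `[{x³ + 4x > 0}, a/√(x³ + 4x)]` is a genuine `KZ.IntegralRep 1` (literal shape at
`(A, B) = (4, 0)`). [cite: KontsevichZagier2001, §1.1] -/
theorem exists_rep_four (a : ℚ) : ∃ r : KZ.IntegralRep 1,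
    r.domain = {x : Fin 1 → ℝ | 0 < x 0 ^ 3 + ((4 : ℤ) : ℝ) * x 0 + ((0 : ℤ) : ℝ)} ∧
    r.integrand = fun x => (a : ℝ) / Real.sqrt (x 0 ^ 3 + ((4 : ℤ) : ℝ) * x 0 + ((0 : ℤ) : ℝ)) := by
  have hmp := MeasureTheory.volume_preserving_funUnique (Fin 1) ℝ
  have hset : {x : Fin 1 → ℝ | 0 < x 0 ^ 3 + ((4 : ℤ) : ℝ) * x 0 + ((0 : ℤ) : ℝ)} =
      (MeasurableEquiv.funUnique (Fin 1) ℝ) ⁻¹' Ioi 0 := by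
    ext x
    simp only [Int.cast_ofNat, Int.cast_zero, add_zero, mem_setOf_eq, mem_preimage, mem_Ioi]
    rw [cube_add_four_mul_pos_iff]
    simp [MeasurableEquiv.funUnique, Fin.default_eq_zero]
  have hint : IntegrableOn (fun x : Fin 1 → ℝ => (a : ℝ) / Real.sqrt (x 0 ^ 3 + ((4 : ℤ) : ℝ) * x 0 + ((0 : ℤ) : ℝ)))
      {x : Fin 1 → ℝ | 0 < x 0 ^ 3 + ((4 : ℤ) : ℝ) * x 0 + ((0 : ℤ) : ℝ)} := by
    rw [hset]
    have h := (hmp.integrableOn_comp_preimage (MeasurableEquiv.measurableEmbedding _)).mpr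
      (integrableOn_inv_sqrt_cube_add_four_mul.const_mul (a : ℝ))
    refine IntegrableOn.congr_fun h (fun x _ => ?_) (measurableSet_Ioi.preimage (MeasurableEquiv.measurable _))
    simp [MeasurableEquiv.funUnique, Fin.default_eq_zero, div_eq_mul_inv]
  exact ⟨{ domain := _, integrand := _,
           isSemialgebraic_domain := isSemialgebraic_setOf_cubic_pos 4 0,
           isSemialgebraicFunOn_integrand := isSemialgebraicFunOn_integrand 4 0 a,
           integrableOn := hint }, rfl, rfl⟩

/-! #### Two NAIVE transfer constants are refuted by the lemniscate pair -/

/-- **The transfer constant is not `1/|c|`.** Natural strengthening "an x-map datum `(f,g,c)`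
transfers `[{P>0}, a/√P]` to `[{P′>0}, (a/|c|)/√P′]`" (forgetting the real-fibre multiplicity) is
FALSE: the lemniscate datum (`c = 1`) would give `Ω(x³−x) = Ω(x³+4x)` and its dual (`c = 2`) would
give `Ω(x³+4x) = Ω(x³−x)/2`, whence `Ω(x³−x) = 0`; but `Ω > 0`. (Truth: `Ω(x³−x) = 2·Ω(x³+4x)`,
multiplicity `m₀ = 2`.) [folklore] -/
theorem not_naiveMultiplier : ¬ (∀ (A B A' B' : ℤ), 4 * A ^ 3 + 27 * B ^ 2 ≠ 0 → 4 * A' ^ 3 + 27 * B' ^ 2 ≠ 0 →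
    ∀ (f g : ℚ[X]) (c : ℚ), derivative f * g - f * derivative g ≠ 0 →
      C (c ^ 2) * g * (f ^ 3 + C (A' : ℚ) * f * g ^ 2 + C (B' : ℚ) * g ^ 3) =
        (X ^ 3 + C (A : ℚ) * X + C (B : ℚ)) * (derivative f * g - f * derivative g) ^ 2 →
    ∀ (a : ℚ), 0 < a → ∀ (r r' : KZ.IntegralRep 1),
      r.domain = {x | 0 < x 0 ^ 3 + (A : ℝ) * x 0 + (B : ℝ)} →
      EqOn r.integrand (fun x => (a : ℝ) / Real.sqrt (x 0 ^ 3 + (A : ℝ) * x 0 + (B : ℝ))) r.domain →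
      r'.domain = {x | 0 < x 0 ^ 3 + (A' : ℝ) * x 0 + (B' : ℝ)} →
      EqOn r'.integrand (fun x => ((a / |c| : ℚ) : ℝ) / Real.sqrt (x 0 ^ 3 + (A' : ℝ) * x 0 + (B' : ℝ))) r'.domain →
      KZ.Equivalent r r') := by
  intro h
  obtain ⟨rL, hdL, hiL⟩ := exists_rep_lemniscate 1
  obtain ⟨r4, hd4, hi4⟩ := exists_rep_four 1
  obtain ⟨rL', hdL', hiL'⟩ := exists_rep_lemniscate (1 / 2)
  -- datum 1: lemniscate, c = 1
  have hW1 : derivative (X ^ 2 - 1 : ℚ[X]) * X - (X ^ 2 - 1) * derivative X ≠ 0 := by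
    have hW : derivative (X ^ 2 - 1 : ℚ[X]) * X - (X ^ 2 - 1) * derivative X = X ^ 2 + 1 := by
      simp only [derivative_sub, derivative_X_pow, derivative_one, derivative_X, Nat.cast_ofNat,
        map_ofNat, Nat.add_one_sub_one, pow_one]
      ring
    rw [hW]; intro h0
    have := congrArg (fun p : ℚ[X] => p.eval 0) h0
    norm_num at this
  have hI1 : C ((1 : ℚ) ^ 2) * (X : ℚ[X]) * ((X ^ 2 - 1) ^ 3 + C ((4 : ℤ) : ℚ) * (X ^ 2 - 1) * X ^ 2 +
        C ((0 : ℤ) : ℚ) * X ^ 3) =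
      (X ^ 3 + C ((-1 : ℤ) : ℚ) * X + C ((0 : ℤ) : ℚ)) *
        (derivative (X ^ 2 - 1 : ℚ[X]) * X - (X ^ 2 - 1) * derivative X) ^ 2 := by
    refine Polynomial.funext fun x => ?_
    simp only [derivative_sub, derivative_X_pow, derivative_one, derivative_X, Nat.cast_ofNat,
      map_ofNat, Nat.add_one_sub_one, pow_one]
    simp; ring
  -- datum 2: the dual, c = 2
  have hW2 : derivative (X ^ 2 + 4 : ℚ[X]) * (4 * X) - (X ^ 2 + 4) * derivative (4 * X) ≠ 0 := by
    have hW : derivative (X ^ 2 + 4 : ℚ[X]) * (4 * X) - (X ^ 2 + 4) * derivative (4 * X) =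
        4 * X ^ 2 - 16 := by
      simp only [derivative_add, derivative_X_pow, derivative_mul, derivative_X, Nat.cast_ofNat,
        map_ofNat, derivative_ofNat, Nat.add_one_sub_one, pow_one, zero_mul, zero_add, add_zero,
        mul_one]
      ring
    rw [hW]; intro h0
    have := congrArg (fun p : ℚ[X] => p.eval 0) h0
    norm_num at this
  have hI2 : C ((2 : ℚ) ^ 2) * (4 * X : ℚ[X]) * ((X ^ 2 + 4) ^ 3 + C ((-1 : ℤ) : ℚ) * (X ^ 2 + 4) * (4 * X) ^ 2 +
        C ((0 : ℤ) : ℚ) * (4 * X) ^ 3) =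
      (X ^ 3 + C ((4 : ℤ) : ℚ) * X + C ((0 : ℤ) : ℚ)) *
        (derivative (X ^ 2 + 4 : ℚ[X]) * (4 * X) - (X ^ 2 + 4) * derivative (4 * X)) ^ 2 := by
    refine Polynomial.funext fun x => ?_
    simp only [derivative_add, derivative_X_pow, derivative_mul, derivative_X, Nat.cast_ofNat,
      map_ofNat, derivative_ofNat, Nat.add_one_sub_one, pow_one, zero_mul, zero_add, add_zero,
      mul_one]
    simp; ring
  have e1 : KZ.Equivalent rL r4 :=
    h (-1) 0 4 0 (by norm_num) (by norm_num) (X ^ 2 - 1) X 1 hW1 hI1 1 one_pos rL r4 hdL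
      (fun x _ => by rw [hiL]) hd4 (fun x _ => by rw [hi4]; norm_num)
  have e2 : KZ.Equivalent r4 rL' :=
    h 4 0 (-1) 0 (by norm_num) (by norm_num) (X ^ 2 + 4) (4 * X) 2 hW2 hI2 1 one_pos r4 rL' hd4
      (fun x _ => by rw [hi4]) hdL' (fun x _ => by rw [hiL']; norm_num)
  have v1 := KZ.Equivalent.value_eq_holds e1
  have v2 := KZ.Equivalent.value_eq_holds e2
  rw [value_eq (A := -1) (B := 0) (a := 1) rL hdL (fun x _ => by rw [hiL]),
    value_eq (A := 4) (B := 0) (a := 1) r4 hd4 (fun x _ => by rw [hi4])] at v1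
  rw [value_eq (A := 4) (B := 0) (a := 1) r4 hd4 (fun x _ => by rw [hi4]),
    value_eq (A := -1) (B := 0) (a := 1 / 2) rL' hdL' (fun x _ => by rw [hiL'])] at v2
  have hΩ := period_pos (A := -1) (B := 0)
    (integrableOn_of_rep (a := 1) rL hdL (fun x _ => by rw [hiL]) one_ne_zero)
  push_cast at v1 v2
  linarith

/-- **The transfer constant is not `deg R/|c|` either.** Natural strengthening "a datum of degree
`d = max(deg f, deg g)` transfers `[{P>0}, a/√P]` to `[{P′>0}, (a·d/|c|)/√P′]`" (every fibre
full) is FALSE: true for the lemniscate datum (`d = 2`, `c = 1`, giving the correct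
`Ω(x³−x) = 2Ω(x³+4x)`) but for its dual (`d = 2`, `c = 2`) it gives `Ω(x³+4x) = Ω(x³−x)`, whence
`Ω(x³−x) = 0`. So the real-fibre multiplicity `m₀ + m₁` (here `2` resp. `2 + 0` — NOT `d` on each
component) is essential bookkeeping. [folklore] -/
theorem not_naiveDegree : ¬ (∀ (A B A' B' : ℤ), 4 * A ^ 3 + 27 * B ^ 2 ≠ 0 → 4 * A' ^ 3 + 27 * B' ^ 2 ≠ 0 →
    ∀ (f g : ℚ[X]) (c : ℚ), derivative f * g - f * derivative g ≠ 0 →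
      C (c ^ 2) * g * (f ^ 3 + C (A' : ℚ) * f * g ^ 2 + C (B' : ℚ) * g ^ 3) =
        (X ^ 3 + C (A : ℚ) * X + C (B : ℚ)) * (derivative f * g - f * derivative g) ^ 2 →
    ∀ (a : ℚ), 0 < a → ∀ (r r' : KZ.IntegralRep 1),
      r.domain = {x | 0 < x 0 ^ 3 + (A : ℝ) * x 0 + (B : ℝ)} →
      EqOn r.integrand (fun x => (a : ℝ) / Real.sqrt (x 0 ^ 3 + (A : ℝ) * x 0 + (B : ℝ))) r.domain →
      r'.domain = {x | 0 < x 0 ^ 3 + (A' : ℝ) * x 0 + (B' : ℝ)} →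
      EqOn r'.integrand (fun x => ((a * (max f.natDegree g.natDegree : ℕ) / |c| : ℚ) : ℝ) /
        Real.sqrt (x 0 ^ 3 + (A' : ℝ) * x 0 + (B' : ℝ))) r'.domain →
      KZ.Equivalent r r') := by
  intro h
  obtain ⟨rL, hdL, hiL⟩ := exists_rep_lemniscate 1
  obtain ⟨r4, hd4, hi4⟩ := exists_rep_four 1
  obtain ⟨r4', hd4', hi4'⟩ := exists_rep_four 2
  have hW1e : derivative (X ^ 2 - 1 : ℚ[X]) * X - (X ^ 2 - 1) * derivative X = X ^ 2 + 1 := by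
    simp only [derivative_sub, derivative_X_pow, derivative_one, derivative_X, Nat.cast_ofNat,
      map_ofNat, Nat.add_one_sub_one, pow_one]
    ring
  have hW1 : derivative (X ^ 2 - 1 : ℚ[X]) * X - (X ^ 2 - 1) * derivative X ≠ 0 := by
    rw [hW1e]; intro h0
    have := congrArg (fun p : ℚ[X] => p.eval 0) h0
    norm_num at this
  have hI1 : C ((1 : ℚ) ^ 2) * (X : ℚ[X]) * ((X ^ 2 - 1) ^ 3 + C ((4 : ℤ) : ℚ) * (X ^ 2 - 1) * X ^ 2 +
        C ((0 : ℤ) : ℚ) * X ^ 3) =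
      (X ^ 3 + C ((-1 : ℤ) : ℚ) * X + C ((0 : ℤ) : ℚ)) *
        (derivative (X ^ 2 - 1 : ℚ[X]) * X - (X ^ 2 - 1) * derivative X) ^ 2 := by
    refine Polynomial.funext fun x => ?_
    rw [hW1e]; simp; ring
  have hW2e : derivative (X ^ 2 + 4 : ℚ[X]) * (4 * X) - (X ^ 2 + 4) * derivative (4 * X) =
      4 * X ^ 2 - 16 := by
    simp only [derivative_add, derivative_X_pow, derivative_mul, derivative_X, Nat.cast_ofNat,
      map_ofNat, derivative_ofNat, Nat.add_one_sub_one, pow_one, zero_mul, zero_add, add_zero,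
      mul_one]
    ring
  have hW2 : derivative (X ^ 2 + 4 : ℚ[X]) * (4 * X) - (X ^ 2 + 4) * derivative (4 * X) ≠ 0 := by
    rw [hW2e]; intro h0
    have := congrArg (fun p : ℚ[X] => p.eval 0) h0
    norm_num at this
  have hI2 : C ((2 : ℚ) ^ 2) * (4 * X : ℚ[X]) * ((X ^ 2 + 4) ^ 3 + C ((-1 : ℤ) : ℚ) * (X ^ 2 + 4) * (4 * X) ^ 2 +
        C ((0 : ℤ) : ℚ) * (4 * X) ^ 3) =
      (X ^ 3 + C ((4 : ℤ) : ℚ) * X + C ((0 : ℤ) : ℚ)) *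
        (derivative (X ^ 2 + 4 : ℚ[X]) * (4 * X) - (X ^ 2 + 4) * derivative (4 * X)) ^ 2 := by
    refine Polynomial.funext fun x => ?_
    rw [hW2e]; simp; ring
  -- degrees: both data have `max (deg f) (deg g) = 2`
  have hd1 : max (X ^ 2 - 1 : ℚ[X]).natDegree (X : ℚ[X]).natDegree = 2 := by
    rw [natDegree_X, natDegree_sub_eq_left_of_natDegree_lt] <;> simp
  have hd2 : max (X ^ 2 + 4 : ℚ[X]).natDegree (4 * X : ℚ[X]).natDegree = 2 := by
    have h1 : (X ^ 2 + 4 : ℚ[X]).natDegree = 2 := by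
      rw [natDegree_add_eq_left_of_natDegree_lt] <;> simp
    have h2 : (4 * X : ℚ[X]).natDegree = 1 := by
      rw [show (4 : ℚ[X]) = C 4 by simp [map_ofNat], natDegree_C_mul_X 4 (by norm_num)]
    rw [h1, h2]; norm_num
  have e1 : KZ.Equivalent rL r4' :=
    h (-1) 0 4 0 (by norm_num) (by norm_num) (X ^ 2 - 1) X 1 hW1 hI1 1 one_pos rL r4' hdL
      (fun x _ => by rw [hiL]) hd4' (fun x _ => by rw [hi4', hd1]; norm_num)
  have e2 : KZ.Equivalent r4 rL :=
    h 4 0 (-1) 0 (by norm_num) (by norm_num) (X ^ 2 + 4) (4 * X) 2 hW2 hI2 1 one_pos r4 rL hd4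
      (fun x _ => by rw [hi4]) hdL (fun x _ => by rw [hiL, hd2]; norm_num)
  have v1 := KZ.Equivalent.value_eq_holds e1
  have v2 := KZ.Equivalent.value_eq_holds e2
  rw [value_eq (A := -1) (B := 0) (a := 1) rL hdL (fun x _ => by rw [hiL]),
    value_eq (A := 4) (B := 0) (a := 2) r4' hd4' (fun x _ => by rw [hi4'])] at v1
  rw [value_eq (A := 4) (B := 0) (a := 1) r4 hd4 (fun x _ => by rw [hi4]),
    value_eq (A := -1) (B := 0) (a := 1) rL hdL (fun x _ => by rw [hiL])] at v2
  have hΩ := period_pos (A := -1) (B := 0)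
    (integrableOn_of_rep (a := 1) rL hdL (fun x _ => by rw [hiL]) one_ne_zero)
  push_cast at v1 v2
  linarith

end Summit.KontsevichZagierPeriods.Cruxes.XMapPeriodTransfer.Disproof
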